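import Summits.BirchSwinnertonDyer.Rank1Residual.X2.NonsplitControlLinks
import Summits.BirchSwinnertonDyer.Rank1Residual.X11b.RouteR1HalvesPointwise
import HarnessLib

/-!
# O9 ∩ {non-split}: the composite input (IMC)∘(BDP)@𝟙 SPLIT INTO ITS TWO HALVES on tree objects —
# H3 `R1.IMCEqOnTreeAt` (Keller–Yin Thm. D shape: `Ch_Λ(X_ac)·R₀⟦T⟧ = (L)`) and H2
# `R1.BDPValueAtOneOnTreeAt` (p-adic Waldspurger value shape: `L(𝟙) = u·((1 − a_p p⁻¹)·log_ω P)²`),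
# the control input being the THEOREM of `X2/NonsplitControl.lean` (cell `bsd-eis`, seat `bsd-eis-cgshw`;
# TARGET §1.3 ROUTING v1.4 (3)(b1) / v1.5 (6): halves after the CTL memo)

HONEST FRAMING (cell `bsd-eis`): theorems only; nothing booked; X2 stays CONSTRUCTION-SHAPED. The X11b
seats typed, for route R1, the two halves of the composite open input `IMCWaldspurgerOnTreeAt` as
POINTWISE shapes on a frame `L ∈ R₀⟦T⟧` (`X11b/RouteR1HalvesPointwise.lean`: `R1.IMCEqOnTreeAt W p κ 𝔭 γ L`,
`R1.BDPValueAtOneOnTreeAt W p ι P L a`) and proved `R1.imcWaldspurgerOnTreeAt_of_halves` from CTL₀'s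
`HasCharValuationAt n`. Those shapes carry NO route-R1 data, so they serve X2 verbatim: here the
`HasCharValuationAt n` comes from `X2.controlOnTreeAt_of_not_split_of_rankOne` (the control theorem at
a non-split Tate prime, any image of `E[p]`) and `p ∤ a_p` from `Mult` (`R1.not_dvd_lFunction_of_mult`).
Result: at an X2c ∩ {non-split} Heegner datum, `BSD(E,p)` from published + cited facts and, for SOME
frame `L`, the two typed halves H3 (Keller–Yin Thm. D = v2 5.1.3 for that `L`: PREPRINT; D′/D″ per
bsd-eis-ky MEMO-2) and H2 (Castella JIMJ 17 Thm. 2.11 shape: PUBLISHED at p ≥ 5 for both signs, NOT in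
print at p = 3 ‖ N; its (HK) `p ∤ h_K` is load-bearing as printed via [Cas20] Def. 1.3 — TARGET §1.3
ROUTING v1.5 (4): recorded here in the docstring, the frame `L` being a free variable). The EXISTENCE
of a frame (`IsBDPLFunction …`: Castella 2018 Thm. 3.1 binds `5 ≤ p ∧ Squarefree N ∧ Irr` — unusable on
X2; Hsieh 2014 Thm. A, tree `hsieh2014_exists_anticyclotomicPAdicLFunction`, odd p, ¬p² ∣ N, no image
hypothesis — the (b1) road) is NOT supplied here: `L` is universally quantified, so nothing is smuggled
and nothing vacuous is claimed (a consumer must produce `L` with H2 ∧ H3).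

References: [Castella2018] Thm. 3.2, §5; [Castella2018Erratum] Thm. 1.1 (shape); [KellerYin2024]
Thm. D; [CastellaEtAl2021] Thm. 5.3.1; [Miller2011LMS] Def. 1.1.
-/

set_option autoImplicit false

noncomputable section

open scoped Classical MatrixGroups ModularForm

open CongruenceSubgroup WeierstrassCurve NumberField IsDedekindDomain Field PowerSeries
  Literature.NumberTheory.EllipticCurves Literature.NumberTheory.EllipticCurves.GreenbergSelmer
  Literature.NumberTheory.EllipticCurves.ModularForms
  Literature.NumberTheory.EllipticCurves.Rank1Residual
  Literature.NumberTheory.EllipticCurves.Rank1Residual.Typed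
  Literature.NumberTheory.EllipticCurves.GreenbergVatsal2000
  Literature.NumberTheory.EllipticCurves.Wuthrich2014
  Literature.NumberTheory.EllipticCurves.SteinWuthrich2013
  Literature.NumberTheory.GaloisRepresentations Literature.NumberTheory.GaloisCohomology
  Literature.NumberTheory.Automorphic
  Summit.BirchSwinnertonDyer.Rank1Residual.X11b.AcSelmer
  Summit.BirchSwinnertonDyer.Rank1Residual.X11b.Halves
  Summit.BirchSwinnertonDyer.Rank1Residual.X11b

namespace Summit.BirchSwinnertonDyer.Rank1Residual.X2

variable (W : WeierstrassCurve ℚ) [W.IsElliptic] [W.IsGloballyMinimal] (p : ℕ) [Fact p.Prime]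

/-- **HALVES ⟹ the composite input, at a NON-SPLIT rank-one multiplicative pair (any image of `E[p]`).**
With the control theorem `controlOnTreeAt_of_not_split_of_rankOne` supplying CTL₀'s
`HasCharValuationAt n` and `Mult` supplying `p ∤ a_p(E)`: for every frame `L ∈ R₀⟦T⟧`, H3
`R1.IMCEqOnTreeAt W p κ 𝔭 γ L` ∧ H2 `R1.BDPValueAtOneOnTreeAt W p (embAt K p 𝔭) P L (a_p)` ⟹
`IMCWaldspurgerOnTreeAt p κ 𝔭 γ (embAt K p 𝔭) P` (`R1.imcWaldspurgerOnTreeAt_of_halves`). CONDITIONAL on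
the cited facts of the control theorem and on the two halves. [cite: Castella2018, §5 (5.1) (arXiv:1704.06608 p. 12)]
[cite: Castella2018Erratum, Thm. 1.1 (p. 1) (shape only)] -/
theorem imcWaldspurgerOnTreeAt_of_halves_of_not_split_of_rankOne
    (hGZK : rank_eq_analyticRank_of_analyticRank_le_one) (hnf : exists_isNewformOf)
    (hPT : ∀ (K : Type) [Field K] [NumberField K], poitouTate_selmerStructure_duality K)
    (hPT2 : ∀ (K : Type) [Field K] [NumberField K], poitouTate_sha_tateDual K)
    (hEP : ∀ (K : Type) [Field K] [NumberField K] (v : HeightOneSpectrum (𝓞 K)),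
      localEulerPoincareCharacteristic (v.adicCompletion K))
    (hcd : fieldCdLE_two_of_numberField)
    (hBr : ∀ (K : Type) [Field K] [NumberField K] (p : ℕ) [Fact p.Prime],
      ZpExtension.decomp_not_le_kerSubgroup_of_isAnticyclotomic K p)
    (hp2 : p ≠ 2) (hmult : Mult W p) (hns : ¬ W.HasSplitMultiplicativeReductionAtPrime p)
    (hr : W.analyticRank = 1) {K : Type} [Field K] [NumberField K] (hK : IsImaginaryQuadratic K)
    (hsplit : SplitsIn K p) (hLt : (W.quadraticTwist (NumberField.discr K : ℚ)).entireLFunction 1 ≠ 0)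
    (P : (W.baseChange K).toAffine.Point) (hPinf : ¬ IsOfFinAddOrder P)
    (κ : ZpExtension K p) (hκ : κ.IsAnticyclotomic) (γ : absoluteGaloisGroup K)
    [Fact (κ.IsTopGenerator γ)] (𝔭 : HeightOneSpectrum (𝓞 K))
    (h𝔭 : ((p : ℕ) : 𝓞 K) ∈ 𝔭.asIdeal) (he : 𝔭.asIdeal.ramificationIdx (𝓞 ℚ) = 1)
    (hf : 𝔭.asIdeal.inertiaDeg (𝓞 ℚ) = 1) (L : UnrSeries p)
    (h3 : R1.IMCEqOnTreeAt W p κ 𝔭 γ L)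
    (h2 : R1.BDPValueAtOneOnTreeAt W p (embAt K p 𝔭 h𝔭 he hf) P L (W.LFunction p)) :
    IMCWaldspurgerOnTreeAt p κ 𝔭 γ (embAt K p 𝔭 h𝔭 he hf) P := by
  haveI : NeZero (W.conductorNorm ℤ) := ⟨(W.conductorNorm_pos_holds).ne'⟩
  obtain ⟨f, hfW⟩ := hnf W
  obtain ⟨n, hn, -⟩ := controlOnTreeAt_of_not_split_of_rankOne W p hGZK hnf hPT hPT2 hEP hcd hBr hp2
    hmult hns hr hK hsplit hLt P hPinf κ hκ γ 𝔭 h𝔭 he hf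
  exact R1.imcWaldspurgerOnTreeAt_of_halves hn h3 (R1.not_dvd_lFunction_of_mult hfW hmult) h2

/-- **O9 sub-cell `CellCNonsplitNotGV` at a Heegner datum FROM THE TWO HALVES** (the composite input of
`bsdp_of_cellCNonsplitNotGV_of_imcWaldspurgerOnTree` split): `BSD(E,p)` from the PUBLISHED facts of
`X2/RankOneChain`, GZK/modularity, the FIVE cited cohomological facts, and — for SOME frame `L ∈ R₀⟦T⟧`
— H3 `R1.IMCEqOnTreeAt W p κ 𝔭 γ L` (Keller–Yin Thm. D shape, PREPRINT) and H2
`R1.BDPValueAtOneOnTreeAt W p (embAt K p 𝔭) P L (a_p)` (Castella JIMJ 17 Thm. 2.11 shape: PUB at p ≥ 5,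
both signs; NOT in print at p = 3 ‖ N; (HK) `p ∤ h_K` load-bearing as printed). The control and
Tamagawa links are theorems. CONDITIONAL; nothing booked. [claim: KellerYin2024, status: under-review]
[cite: CastellaEtAl2021, Thm. 5.3.1] [cite: Castella2018, Thm. 2.3, Thm. 3.2 and §5] [cite: Miller2011LMS, Def. 1.1] -/
theorem bsdp_of_cellCNonsplitNotGV_of_halves
    (hGV : lambdaMu_multiplicative_of_gvPar) (hWu : thm16_charIdeal_dvd_multiplicative_of_reducible)
    (hJs : thm61_splitMultiplicative) (hJn : thm61_nonsplitMultiplicative)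
    (hHs : exists_isSplitMultCanonical) (hHn : exists_isMultCanonical)
    (hpar : nonempty_modularParametrizationData)
    (hGS : ∀ (W : WeierstrassCurve ℚ) [W.IsElliptic] [W.IsGloballyMinimal] (p : ℕ) [Fact p.Prime],
      greenberg_stevens (W := W) (p := p))
    (hnf : exists_isNewformOf)
    (hPT : ∀ (K : Type) [Field K] [NumberField K], poitouTate_selmerStructure_duality K)
    (hPT2 : ∀ (K : Type) [Field K] [NumberField K], poitouTate_sha_tateDual K)
    (hEP : ∀ (K : Type) [Field K] [NumberField K] (v : HeightOneSpectrum (𝓞 K)),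
      localEulerPoincareCharacteristic (v.adicCompletion K))
    (hcd : fieldCdLE_two_of_numberField)
    (hBr : ∀ (K : Type) [Field K] [NumberField K] (p : ℕ) [Fact p.Prime],
      ZpExtension.decomp_not_le_kerSubgroup_of_isAnticyclotomic K p)
    (N : ℕ) [NeZero N] (K : Type) [Field K] [NumberField K]
    (Dt : ModularParametrizationData W N) (H : HeegnerDatum N (NumberField.discr K)) (ι : K →+* ℂ)
    (P : (W.baseChange K).toAffine.Point)
    (hGZ : gross_zagier N W K) (hKo : kolyvagin N W K)
    (hGZK : rank_eq_analyticRank_of_analyticRank_le_one)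
    (hc : CellCNonsplitNotGV W p) (hN : W.conductorNorm ℤ = N) (hK : IsImaginaryQuadratic K)
    (hd4 : NumberField.discr K < -4) (hHN : SatisfiesHeegnerHypothesis N K)
    (hsplit : SatisfiesHeegnerHypothesis p K)
    (hP : WeierstrassCurve.Affine.Point.map ι.toRatAlgHom P = heegnerPointComplex Dt H)
    (hPinf : ¬ IsOfFinAddOrder P) (hcM : ¬ (p : ℤ) ∣ Dt.c)
    (hLt : (W.quadraticTwist (NumberField.discr K : ℚ)).entireLFunction 1 ≠ 0)
    (Wd : WeierstrassCurve ℚ) [Wd.IsElliptic] [Wd.IsGloballyMinimal] (Cd : VariableChange ℚ)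
    (hWd : Cd • W.quadraticTwist (NumberField.discr K : ℚ) = Wd)
    (htam : padicValNat p Wd.tamagawaProduct = padicValNat p W.tamagawaProduct)
    (hu : padicValRat p (Cd.u : ℚ) = 0)
    (htamK : padicValNat p (W.baseChange K).tamagawaProduct = 2 * padicValNat p W.tamagawaProduct)
    (κ : ZpExtension K p) (hκ : κ.IsAnticyclotomic) (γ : absoluteGaloisGroup K)
    [Fact (κ.IsTopGenerator γ)] (𝔭 : HeightOneSpectrum (𝓞 K))
    (h𝔭 : ((p : ℕ) : 𝓞 K) ∈ 𝔭.asIdeal) (he : 𝔭.asIdeal.ramificationIdx (𝓞 ℚ) = 1)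
    (hf : 𝔭.asIdeal.inertiaDeg (𝓞 ℚ) = 1) (L : UnrSeries p)
    (h3 : R1.IMCEqOnTreeAt W p κ 𝔭 γ L)
    (h2 : R1.BDPValueAtOneOnTreeAt W p (embAt K p 𝔭 h𝔭 he hf) P L (W.LFunction p)) : BSDp W p :=
  bsdp_of_cellCNonsplitNotGV_of_imcWaldspurgerOnTree hGV hWu hJs hJn hHs hHn hpar hGS hnf hPT hPT2
    hEP hcd hBr W p N K Dt H ι P hGZ hKo hGZK hc hN hK hd4 hHN hsplit hP hPinf hcM hLt Wd Cd hWd htam hu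
    htamK κ hκ γ 𝔭 h𝔭 he hf
    (imcWaldspurgerOnTreeAt_of_halves_of_not_split_of_rankOne W p hGZK hnf hPT hPT2 hEP hcd hBr
      hc.1.2.1 hc.1.2.2.2 hc.2.1 hc.1.1 hK (hsplit p Fact.out dvd_rfl) hLt P hPinf κ hκ γ 𝔭 h𝔭 he hf L
      h3 h2)

end Summit.BirchSwinnertonDyer.Rank1Residual.X2

end
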